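import Summits.QuantumFields.YangMills.Theorems.UnitScaleTiltProp7B8Prop7Plaq
import Summits.QuantumFields.YangMills.Theorems.UnitScaleTiltProp7PV3CDELogChart
import HarnessLib

/-!
# Route `UnitScaleTilt`, crux K1 child «MinimiserStabilityRegPr» (stmt-QuantumFields-19200), registered stub `stub_prop7From14` (skeleton birth_v7
# cc37a178…; leaf V3) — pillar P-V3-CDE, native row (D) «the p. 299 return to (18)» REDUCED TO ONE GAUGE-INVARIANT ESTIMATE: for every presentation
# whose «critical in (19)–(21)» letter is the CHART IMAGE of a configuration critical in reading R2 (seat w1's `CritL`), row (D) follows from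
# «(19) at `ε₂` over `U₀ ∈ 𝔘_k(a)`, `a ≤ ε₂ ≤ c` ⇒ `U₁U₀ ∈ 𝔘_k(O·ε₂)`», whose plaquette half is `Prop7B8Prop7Plaq` — so the REMAINING content of (D) is
# the covariant-divergence half of that estimate

Cell `ym3-torus`, width seat `ym-ust-19200-w2` (gen 0; D-0149; OWNER W-SEAT START LIST 2026-08-27 22:29Z «w2 = P-V3-CDE»).  YM₃ on T³ is a ladder rung (R3),
not the Clay problem; nothing here is a claim about the crux, d = 4 or the mass gap.

THE PRINT.  [Balaban1985Variational] p. 299: *«Now we take the configuration U₁U₀ and we apply to it a gauge transformation u satisfying the conditions \overline{R₀u}ʲ = 1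
on Λ_j, and such that the gauge transformed configuration (U₁U₀)^u satisfies the axial gauge conditions Ax_k(𝔅_k, U₀). Let us define U_k = (U₁U₀)^u. Proposition 7 [6]
implies that U_k belongs to the space (18) with ε₀ = O(1)C₁B₃ε₁. It is a critical configuration of the functional (5).»*  [6] = [Balaban1985RegularSpaces], Prop. 7
p. 98; (2) p. 278 *«|U(∂p) − 1| < ε₀η²(Lʲη)⁻², |(D*_U∂U)(b)| < ε₀η²(Lʲη)⁻³»*; p. 278 *«The space 𝔘_k({Ω_j}, ε₀) is gauge invariant»*.

WHAT IS PROVED (sorry-free, no definition).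
§1 `regPr_emb15_of_in19_of_div` — `RegPr (O·ε₂) (U₁U₀)` from (19) at `ε₂ ≤ min{c, ¼}` over `U₀ ∈ 𝔘_k(a)`, `a ≤ ε₂`, GIVEN the divergence-clause estimate as a
   hypothesis (the plaquette clause is `Prop7B8Prop7Plaq.plaqSmall_emb15_of_in19`, radius `13ε₂`); `O = max{13, O′}`.
§2 **`rowD_of_chartCritL_of_divEstimate`** — the hypothesis (D) of `Prop7PV3CDELogChart.prop7From14At_of_natives_logChart`, for every presentation `A` over `Idx L`
   whose `CritL V U₀ U₁` IMPLIES `∃ u, A.Restricted U₀ u ∧ IsCritR2 V ((U₁U₀)^u)` (the chart-image reading; `IsCritR2` = minimiser over some `(6)(e)`, which lies in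
   `𝔅_k(V)`), from ONE native estimate: «`∃ O′ c′ > 0, ∀ member, a ≤ ε₂ ≤ c′, U₀ ∈ 𝔘_k(a), U₁ in (19) at ε₂ ⇒ D*-clause of (2) for U₁U₀ at radius O′ε₂`».  The
   (1.29)-restriction, (20), (21) and the closeness half of (14) are idle in this row (they serve rows (C)/(E) and clause (i)).
§3 **`prop7From14At_of_natives_logChart_div`** — the knit of `Prop7PV3CDELogChart` with (D) replaced by that divergence estimate: V3 ⇐ P-V3-A ∧ (C) ∧ (D-div) ∧ (E)
   at the log-chart letters over such Sect. A letters.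

HONEST SCOPE.  The divergence-clause estimate ([Balaban1985RegularSpaces] Prop. 7's second half: the codifferential of `∂(U₁U₀)` at a curved background, controlled
by the second-order members `|D^{η*}_{U₀}D^η_{U₀}A|`, `|Δ^η_{U₀}A|` of (19), the gradients, and `U₀`'s own (2)) is a HYPOTHESIS here — the next file of this
seat.  (C), (E), P-V3-A remain hypotheses as in `Prop7PV3CDELogChart`.  Count-neutral helper toward stmt-QuantumFields-19200 (`--supports`), not a proof of the stub.

References: T. Bałaban, CMP 102 (1985) 277–309 [Balaban1985Variational] ((2), (4) p.278, (14)–(21) pp.279–281, p.299, Prop. 7 p.299); CMP 99 (1985) 75–102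
[Balaban1985RegularSpaces] ((1.9) p.77, (1.47) p.84, Prop. 7 p.98).
-/

noncomputable section

namespace Summit.QuantumFields.YangMills.Theorems.Prop7PV3CDERowD

open Literature.MathematicalPhysics.QuantumFieldTheory.Balaban1983to89
open Literature.MathematicalPhysics.QuantumFieldTheory.Balaban1983to89.T3ContinuumYM3Torus
open Literature.MathematicalPhysics.QuantumFieldTheory.Balaban1983to89.T3UnitLawDensityEML (ℰp)
open Literature.MathematicalPhysics.QuantumFieldTheory.Balaban1983to89.T3DescentFibreTower
open Literature.MathematicalPhysics.QuantumFieldTheory.Balaban1983to89.T3ConstrainedMinimiser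
open Literature.MathematicalPhysics.QuantumFieldTheory.Balaban1983to89.T3TiltDescent
open Literature.MathematicalPhysics.QuantumFieldTheory.Balaban1983to89.T3RegularMinimiser (regThreshold)
open Literature.MathematicalPhysics.QuantumFieldTheory.Balaban1983to89.T3PrintedRegularMinimiser
open Literature.MathematicalPhysics.QuantumFieldTheory.Balaban1983to89.T3PrintedMinimiserExistence (regPr_mono plaqSmall_of_le regThreshold_mono)
open Literature.MathematicalPhysics.QuantumFieldTheory.Balaban1983to89.T3PrintedRegularOrbits (descTransf regPr_gaugeAct_iff)
open B11 (VarProblemX LGData Prop2Printed Prop5Printed Prop6Printed)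
open B7Prop1Explicit renaming Site → LSite
open B8Eq119TwistedAxial (InAx Restr129)
open B8Thm4TorusAt (torusLam)
open B15DeterminingSets (embIter)
open B10Eq27TorusAxialLog (pull unitsField toUField)
open B8Thm2SetupTorus (pullGauge toUGauge)
open T3Thm1Carrier
open T3Thm1CarrierNative (IsCritR2 Prop7From14At)
open T3SectALandauChart
open Summit.QuantumFields.YangMills.Theorems.Prop7TPrint
open Summit.QuantumFields.YangMills.Theorems.Prop7B8Prop7Plaq (plaqSmall_emb15_of_in19)
open Summit.QuantumFields.YangMills.Theorems.Prop7PV3CDELogChart (pos_of_in19 prop7From14At_of_natives_logChart)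

open scoped Matrix.Norms.L2Operator

variable {L : ℕ}

/-! ## §1 `U₁U₀ ∈ 𝔘_k(O·ε₂)` from (19), the background's (2), and the divergence-clause estimate -/

/-- **`U₁U₀ ∈ 𝔘_k(max{13, O′}·ε₂)`** for `U₁` in (19) at `ε₂ ≤ min{c, ¼}` over `U₀ ∈ 𝔘_k(a)` with `a ≤ ε₂`: the plaquette clause is `Prop7B8Prop7Plaq` (radius `2a + 11ε₂ ≤ 13ε₂`),
the divergence clause is the hypothesis `hdiv` (radius `O′ε₂`). [cite: Balaban1985RegularSpaces, Prop. 7 p.98, (1.47) p.84; Balaban1985Variational, (2) p.278, (19) p.281] -/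
theorem regPr_emb15_of_in19_of_div (F : T3Family) (n K : ℕ) {O' c ε₂ a : ℝ}
    (hdiv : ∀ (ε₂ a : ℝ) (U₀ U₁ : GaugeField (F.P K) 0 (Matrix.specialUnitaryGroup (Fin 2) ℂ)) (X : PBond (F.P K) 0 → Matrix (Fin 2) (Fin 2) ℂ),
      a ≤ ε₂ → ε₂ ≤ c → RegPr F n K a U₀ → In19 F n K ε₂ U₀ U₁ X → DivSmall F n K (O' * ε₂) (emb15 U₀ U₁))
    {U₀ U₁ : GaugeField (F.P K) 0 (Matrix.specialUnitaryGroup (Fin 2) ℂ)} {X : PBond (F.P K) 0 → Matrix (Fin 2) (Fin 2) ℂ}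
    (ha : a ≤ ε₂) (hc : ε₂ ≤ c) (h4 : ε₂ ≤ 1 / 4) (hU₀ : RegPr F n K a U₀) (h19 : In19 F n K ε₂ U₀ U₁ X) :
    RegPr F n K (max 13 O' * ε₂) (emb15 U₀ U₁) := by
  have hε₂ : 0 < ε₂ := pos_of_in19 h19
  have hpl : PlaqSmall (regThreshold F n K (2 * a + 11 * ε₂)) (emb15 U₀ U₁) := plaqSmall_emb15_of_in19 h4 hU₀.1 h19
  have h13 : 2 * a + 11 * ε₂ ≤ max 13 O' * ε₂ := by
    have : (13 : ℝ) * ε₂ ≤ max 13 O' * ε₂ := mul_le_mul_of_nonneg_right (le_max_left _ _) hε₂.le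
    linarith
  have hO : O' * ε₂ ≤ max 13 O' * ε₂ := mul_le_mul_of_nonneg_right (le_max_right _ _) hε₂.le
  exact ⟨plaqSmall_of_le (regThreshold_mono F h13) hpl, T3PrintedMinimiserExistence.divSmall_mono F hO (hdiv ε₂ a U₀ U₁ X ha hc hU₀ h19)⟩

/-! ## §2 Row (D) from the chart-image reading of «critical in (19)–(21)» and the divergence-clause estimate -/

/-- **ROW (D) OF P-V3-CDE REDUCED**: for a presentation `A` over `Idx L` whose `CritL V U₀ U₁` yields a `Restricted` gauge transformation `u` with `(U₁U₀)^u` critical in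
reading R2 over `V` (seat w1's letter: the chart image; p. 281 «The above mapping is one-to-one» + p. 280 «The functional (5) is gauge invariant»), the p. 299 return to (18)
«Proposition 7 [6] implies that U_k belongs to the space (18) with ε₀ = O(1)C₁B₃ε₁. It is a critical configuration of the functional (5)» in print's regime
`L³B₃ε₁ ≤ ε₂ ≤ c` follows from the divergence-clause estimate `hdiv` (plaquette clause: `Prop7B8Prop7Plaq`; gauge invariance of 𝔘_k: `regPr_gaugeAct_iff`; `𝔅_k(V)`:
the R2-minimiser lies in some `(6)(e) ⊆ 𝔅_k(V)`), with `O₂ = max{13, O′}`, `c = min{c′, ¼}`.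
[cite: Balaban1985Variational, p.299 (before (141)), (4) p.278, p.280, p.281; Balaban1985RegularSpaces, Prop. 7 p.98] -/
theorem rowD_of_chartCritL_of_divEstimate (A : ResidFam L) {B₃ : ℝ}
    (hCrit : ∀ (i : Idx L) (V : GaugeField (i.1.1.P i.1.2.1) 0 (Matrix.specialUnitaryGroup (Fin 2) ℂ))
      (U₀ U₁ : GaugeField (i.1.1.P i.1.2.2) 0 (Matrix.specialUnitaryGroup (Fin 2) ℂ)), (A i).CritL V U₀ U₁ →
        ∃ u : GaugeTransf (i.1.1.P i.1.2.2) 0 (Matrix.specialUnitaryGroup (Fin 2) ℂ), (A i).Restricted U₀ u ∧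
          IsCritR2 i.1.1 i.1.2.1 i.1.2.2 i.2.2.le V (GaugeField.gaugeAct u (emb15 U₀ U₁)))
    (hdiv : ∃ O' c' : ℝ, 0 < c' ∧ ∀ (i : Idx L) (ε₂ a : ℝ) (U₀ U₁ : GaugeField (i.1.1.P i.1.2.2) 0 (Matrix.specialUnitaryGroup (Fin 2) ℂ))
      (X : PBond (i.1.1.P i.1.2.2) 0 → Matrix (Fin 2) (Fin 2) ℂ), a ≤ ε₂ → ε₂ ≤ c' → RegPr i.1.1 i.1.2.1 i.1.2.2 a U₀ → In19 i.1.1 i.1.2.1 i.1.2.2 ε₂ U₀ U₁ X →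
        DivSmall i.1.1 i.1.2.1 i.1.2.2 (O' * ε₂) (emb15 U₀ U₁)) :
    ∃ O₂ c : ℝ, 1 ≤ O₂ ∧ 0 < c ∧ ∀ (i : Idx L) (ε₁ ε₂ : ℝ) (V : GaugeField (i.1.1.P i.1.2.1) 0 (Matrix.specialUnitaryGroup (Fin 2) ℂ))
      (U₀ U₁ : GaugeField (i.1.1.P i.1.2.2) 0 (Matrix.specialUnitaryGroup (Fin 2) ℂ)) (X : PBond (i.1.1.P i.1.2.2) 0 → Matrix (Fin 2) (Fin 2) ℂ),
      (L : ℝ) ^ 3 * B₃ * ε₁ ≤ ε₂ → ε₂ ≤ c → RegPr i.1.1 i.1.2.1 i.1.2.2 ((L : ℝ) ^ 3 * B₃ * ε₁) U₀ → CloseAvg i.1.1 i.1.2.1 i.1.2.2 i.2.2.le ((L : ℝ) ^ 3 * ε₁) V U₀ →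
      In19 i.1.1 i.1.2.1 i.1.2.2 ε₂ U₀ U₁ X → (A i).AvgCond V U₀ X → (A i).IsLandau U₀ X → (A i).CritL V U₀ U₁ →
        ∃ u : GaugeTransf (i.1.1.P i.1.2.2) 0 (Matrix.specialUnitaryGroup (Fin 2) ℂ), (A i).Restricted U₀ u ∧
          RegPr i.1.1 i.1.2.1 i.1.2.2 (O₂ * ε₂) (GaugeField.gaugeAct u (emb15 U₀ U₁)) ∧
          GaugeField.gaugeAct u (emb15 U₀ U₁) ∈ fibre i.1.1 ℰp i.1.2.1 i.1.2.2 i.2.2.le V ∧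
          IsCritR2 i.1.1 i.1.2.1 i.1.2.2 i.2.2.le V (GaugeField.gaugeAct u (emb15 U₀ U₁)) := by
  obtain ⟨O', c', hc', HD⟩ := hdiv
  refine ⟨max 13 O', min c' (1 / 4), le_trans (by norm_num) (le_max_left _ _), lt_min hc' (by norm_num), ?_⟩
  intro i ε₁ ε₂ V U₀ U₁ X ha hc hreg _hclose h19 _h20 _h21 hcrit
  obtain ⟨u, hu, hcritR2⟩ := hCrit i V U₀ U₁ hcrit
  obtain ⟨e, _he, hmem, _hmin⟩ := id hcritR2
  have hfib : GaugeField.gaugeAct u (emb15 U₀ U₁) ∈ fibre i.1.1 ℰp i.1.2.1 i.1.2.2 i.2.2.le V := ((mem_regFibrePr_iff i.1.1).mp hmem).1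
  have hε₂ : 0 < ε₂ := pos_of_in19 h19
  have hreg' : RegPr i.1.1 i.1.2.1 i.1.2.2 (max 13 O' * ε₂) (emb15 U₀ U₁) :=
    regPr_emb15_of_in19_of_div i.1.1 i.1.2.1 i.1.2.2 (HD i) ha (hc.trans (min_le_left _ _)) (hc.trans (min_le_right _ _)) hreg h19
  have hO0 : 0 ≤ max 13 O' * ε₂ := mul_nonneg (le_trans (by norm_num) (le_max_left _ _)) hε₂.le
  exact ⟨u, hu, (regPr_gaugeAct_iff i.1.1 hO0 u _).mpr hreg', hfib, hcritR2⟩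

/-! ## §3 The knit with (D) replaced by the divergence-clause estimate -/

/-- **V3 AT THE LOG-CHART LETTERS FROM P-V3-A, (C), THE DIVERGENCE-CLAUSE ESTIMATE, AND (E)** — `Prop7PV3CDELogChart.prop7From14At_of_natives_logChart` with its
hypothesis (D) discharged by `rowD_of_chartCritL_of_divEstimate`, for Sect. A letters with print's based (1.19)/(1.29) readings AND the chart-image reading of
«critical in (19)–(21)». [cite: Balaban1985Variational, Prop. 7 p.299, Prop. 2 p.281, Props 5-6 pp.294-295, p.299, (141)-(142) p.299; Balaban1985RegularSpaces, Thm 2 p.83, Prop. 7 p.98] -/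
theorem prop7From14At_of_natives_logChart_div (hL : 1 < L) (A : ResidFam L) {B₃ : ℝ} (hB₃ : 1 ≤ B₃)
    (hSax : ∀ (i : Idx L) (U₀ U : GaugeField (i.1.1.P i.1.2.2) 0 (Matrix.specialUnitaryGroup (Fin 2) ℂ)),
      (A i).IsAxial U₀ U ↔
        InAx (i.1.1.P i.1.2.2).L (i.1.2.2 - i.1.2.1) (torusLam (i.1.2.2 - i.1.2.1))
          (pull (unitsField (toUField U₀)) (embIter (i.1.2.2 - i.1.2.1) (0 : Site (i.1.1.P i.1.2.2) (i.1.2.2 - i.1.2.1))))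
          (pull (unitsField (toUField U)) (embIter (i.1.2.2 - i.1.2.1) (0 : Site (i.1.1.P i.1.2.2) (i.1.2.2 - i.1.2.1)))))
    (hSre : ∀ (i : Idx L) (U₀ : GaugeField (i.1.1.P i.1.2.2) 0 (Matrix.specialUnitaryGroup (Fin 2) ℂ))
      (u : GaugeTransf (i.1.1.P i.1.2.2) 0 (Matrix.specialUnitaryGroup (Fin 2) ℂ)), (A i).Restricted U₀ u →
        Restr129 (i.1.1.P i.1.2.2).L (i.1.2.2 - i.1.2.1) (torusLam (i.1.2.2 - i.1.2.1))
          (pull (unitsField (toUField U₀)) (embIter (i.1.2.2 - i.1.2.1) (0 : Site (i.1.1.P i.1.2.2) (i.1.2.2 - i.1.2.1))))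
          (pullGauge (fun x => Unitary.toUnits (toUGauge (i.1.1.P i.1.2.2) 2 u x)) (embIter (i.1.2.2 - i.1.2.1) (0 : Site (i.1.1.P i.1.2.2) (i.1.2.2 - i.1.2.1)))))
    (hCrit : ∀ (i : Idx L) (V : GaugeField (i.1.1.P i.1.2.1) 0 (Matrix.specialUnitaryGroup (Fin 2) ℂ))
      (U₀ U₁ : GaugeField (i.1.1.P i.1.2.2) 0 (Matrix.specialUnitaryGroup (Fin 2) ℂ)), (A i).CritL V U₀ U₁ →
        ∃ u : GaugeTransf (i.1.1.P i.1.2.2) 0 (Matrix.specialUnitaryGroup (Fin 2) ℂ), (A i).Restricted U₀ u ∧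
          IsCritR2 i.1.1 i.1.2.1 i.1.2.2 i.2.2.le V (GaugeField.gaugeAct u (emb15 U₀ U₁)))
    (hA : ∃ B₁ c₁ : ℝ, 0 < B₁ ∧ 0 < c₁ ∧ Prop2Printed B₁ B₃ ((L : ℝ) ^ 3) c₁ (famLG3 L (tPrintFam A)))
    (hC : ∃ B₀ : ℝ, 0 < B₀ ∧ Prop6Printed B₀ B₃ ((L : ℝ) ^ 3) (famLG3 L (tPrintFam A)))
    (hdiv : ∃ O' c' : ℝ, 0 < c' ∧ ∀ (i : Idx L) (ε₂ a : ℝ) (U₀ U₁ : GaugeField (i.1.1.P i.1.2.2) 0 (Matrix.specialUnitaryGroup (Fin 2) ℂ))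
      (X : PBond (i.1.1.P i.1.2.2) 0 → Matrix (Fin 2) (Fin 2) ℂ), a ≤ ε₂ → ε₂ ≤ c' → RegPr i.1.1 i.1.2.1 i.1.2.2 a U₀ → In19 i.1.1 i.1.2.1 i.1.2.2 ε₂ U₀ U₁ X →
        DivSmall i.1.1 i.1.2.1 i.1.2.2 (O' * ε₂) (emb15 U₀ U₁))
    (hE : ∃ e₅ : ℝ, 0 < e₅ ∧ ∀ (i : Idx L) (e ε₁ : ℝ) (V : GaugeField (i.1.1.P i.1.2.1) 0 (Matrix.specialUnitaryGroup (Fin 2) ℂ))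
      (U₀ U₁ : GaugeField (i.1.1.P i.1.2.2) 0 (Matrix.specialUnitaryGroup (Fin 2) ℂ)) (u : GaugeTransf (i.1.1.P i.1.2.2) 0 (Matrix.specialUnitaryGroup (Fin 2) ℂ)),
      e ≤ e₅ → RegPr i.1.1 i.1.2.1 i.1.2.2 ((L : ℝ) ^ 3 * B₃ * ε₁) U₀ → CloseAvg i.1.1 i.1.2.1 i.1.2.2 i.2.2.le ((L : ℝ) ^ 3 * ε₁) V U₀ →
      (A i).CritL V U₀ U₁ → (A i).Restricted U₀ u → RegPr i.1.1 i.1.2.1 i.1.2.2 e (GaugeField.gaugeAct u (emb15 U₀ U₁)) →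
      GaugeField.gaugeAct u (emb15 U₀ U₁) ∈ fibre i.1.1 ℰp i.1.2.1 i.1.2.2 i.2.2.le V →
      IsCritR2 i.1.1 i.1.2.1 i.1.2.2 i.2.2.le V (GaugeField.gaugeAct u (emb15 U₀ U₁)) →
        GaugeField.gaugeAct u (emb15 U₀ U₁) ∈ regFibrePr i.1.1 i.1.2.1 i.1.2.2 i.2.2.le e V ∧
        IsMinOn (fun W : GaugeField (i.1.1.P i.1.2.2) 0 (Matrix.specialUnitaryGroup (Fin 2) ℂ) => wilsonAction4 W)
          (regFibrePr i.1.1 i.1.2.1 i.1.2.2 i.2.2.le e V) (GaugeField.gaugeAct u (emb15 U₀ U₁))) :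
    Prop7From14At L B₃ :=
  prop7From14At_of_natives_logChart hL A hB₃ hSax hSre hA hC (rowD_of_chartCritL_of_divEstimate A hCrit hdiv) hE

end Summit.QuantumFields.YangMills.Theorems.Prop7PV3CDERowD

end
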